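/-
Origin: expansion seat `planner-pub-hodgecm-pv15-g2-0`, handover #3 2026-08-18T06:23:42Z (`HOME/pub-hodgecm-pv15-g2/lean/Pv15g2/CocompactCarrier.lean`, md5 3afee3cd, 214 lines);
landed by the gen-6 packager in gate run 24 as `HodgeCM/Automorphic/CocompactCarrier.lean` (import ^import Pv06g3\.CompactApproxBridge\b→import HodgeCM.Automorphic.CompactApproxBridge ×1; import ^import Pv15g2\.→import HodgeCM.Automorphic. ×1).
-/
/-
Origin: HOME/pub-hodgecm-pv15-g2/lean/Pv15g2/CocompactCarrier.lean — session planner-pub-hodgecm-pv15-g2-0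
(unit pub-hodgecm-pv15-g2, DAG-NODE PROVER #15 gen 2; lineage N23a / the regular-model theta carrier).
Intended final place (packager's call): `HodgeCM/Automorphic/CocompactCarrier.lean`.
NEW, ADDITIVE leaf.  WIP imports ↦ landed names: `Pv15g2.UnfoldedPairing` ↦ `HodgeCM.Automorphic.UnfoldedPairing`
(my HANDOVER #2, run 24), `Pv06g3.CompactApproxBridge` ↦ `HodgeCM.Automorphic.CompactApproxBridge` (seat pv06-g3
HANDOVER #2 fc54d4462945, run 24).  Lands AFTER both.  KIND: KERNEL glue — nothing cited, nothing posited.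
-/
import Summits.HodgeConjecture.HodgeCM.Automorphic.UnfoldedPairing
import Summits.HodgeConjecture.HodgeCM.Automorphic.CompactApproxBridge

/-!
# The cocompact regular-model theta carrier: END STATE with ten named analytic hypotheses per context

PerL v5 ll. 384–385: `U(W)` is anisotropic, so `[U(W)] = U(W)(L₀)\U(W)(𝔸)` is COMPACT.  In the regular model
(`ThetaCarrierReg`: `H = L²(G ⧸ Γ, μQ)`, `R` = the regular representation) seat pv06-g3 proved
(`CompactApprox`, `CompactApproxBridge`, `CompactApproxReg`, run 24) that for `G ⧸ Γ` compact and `μQ` the push-forward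
of a regular Haar measure restricted to a fundamental domain, the DISCRETE DECOMPOSITION of `L²(G ⧸ Γ)` into
irreducibles holds (`CompactApprox.discreteDecomp_haar`) — so `RegCoreCarrier.Analytic` follows from `hatτ_complete`
alone (their `CompactApproxReg`; re-derived here from the `Bridge` file so that this leaf depends on nothing else).

This file only ASSEMBLES, at the level of a whole universe-indexed carrier:

* `RegularRep.IsCocompactHaarModel Γ μQ μ` — the MODEL DATA as one named proposition (all structural, none of PerL's
  analytic claims): `μ` is a regular Haar measure on `G = U(W)(𝔸)` which is also right-invariant (unimodularity),
  `Γ = U(W)(L₀)` is countable, `G ⧸ Γ` is compact (anisotropy, ll. 384–385), and `μQ = map π (μ|𝓕)` for some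
  measurable fundamental domain `𝓕` of `Γ` (acting on the right);
* `RegCoreCarrier.analytic_of_cocompact`, `analyticU_of_cocompact` — the core's analytic record from `hatτ_complete`
  (+ the unit law `ω(1) = id` in the (U)-version), via pv06-g3's theorem;
* `Universe.RegThetaCarrier.AnalyticC` — per seesaw context: the model data, `hatτ_complete`, `omg_one`, and the
  (U)-version torus records (`AX5b_ϑ_cont`, `AX12_transl_cont`, `AX12_unfold`, `AX8_annihilation`) ×2 —
  **2 + 4 + 4 = 10 named analytic propositions per context** (gen 3: 15; my run-24 files: 12, resp. 11);
  `AnalyticC.toAnalyticU`, `AnalyticC.toAnalytic`;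
* END STATE `Assembly.COR_CM_endState_ofRegCarrierC` and `perL_ofRegCarrierC`.
-/

set_option autoImplicit false

noncomputable section

open MeasureTheory Set Filter Function
open scoped InnerProductSpace ENNReal

namespace HodgeCM

/-! ## 1. The cocompact Haar model as one named structural proposition -/

namespace RegularRep

variable {G : Type*} [Group G] [TopologicalSpace G] [MeasurableSpace G] (Γ : Subgroup G)
  [MeasurableSpace (G ⧸ Γ)] (μQ : Measure (G ⧸ Γ)) (μ : Measure G)

/-- **The cocompact Haar model of `[U(W)]`** (structural data, PerL v5 ll. 384–385 + the standard set-up of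
`L²(U(W)(L₀)\U(W)(𝔸))`): `μ` a regular Haar measure on `G`, right-invariant as well (`G` unimodular); `Γ` countable;
`G ⧸ Γ` compact; `μQ` the image of `μ` restricted to a fundamental domain of `Γ`. -/
structure IsCocompactHaarModel : Prop where
  isHaar : μ.IsHaarMeasure
  regular : μ.Regular
  rightInvariant : μ.IsMulRightInvariant
  countable : Countable Γ
  compactQuotient : CompactSpace (G ⧸ Γ)
  exists_fundamentalDomain : ∃ 𝓕 : Set G, IsFundamentalDomain Γ.op 𝓕 μ ∧
    μQ = Measure.map (QuotientGroup.mk : G → G ⧸ Γ) (μ.restrict 𝓕)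

end RegularRep

/-! ## 2. Carrier level: the core's analytic records in the cocompact model -/

namespace RegularRep

open PerL34.QuotientSmoothing

variable {G : Type*} [Group G] [TopologicalSpace G] [IsTopologicalGroup G] {Γ : Subgroup G}
  [MeasurableSpace G] [BorelSpace G] [MeasurableSpace (G ⧸ Γ)] [BorelSpace (G ⧸ Γ)]
  (ν : Measure (G ⧸ Γ)) [SMulInvariantMeasure G (G ⧸ Γ) ν]

/-- `RegularRep.koopman ν` IS the landed `QuotientSmoothing.ρHom ν` (same operator `v ↦ v ∘ (g⁻¹ • ·)`; also seat
pv06-g3's `CompactApprox.regularRep_koopman_eq_ρHom` — restated so that this leaf imports only their `Bridge`). -/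
theorem koopman_eq_ρHom : koopman ν = ρHom ν (G := G) := by
  refine MonoidHom.ext fun g => ContinuousLinearMap.ext fun v => ?_
  change koopman ν g v = ρ ν g v
  apply Lp.ext
  filter_upwards [coeFn_koopman ν g v, coeFn_ρ ν g v] with x h1 h2
  rw [h1, h2]

end RegularRep

namespace RegCoreCarrier

variable {G : Type} [Group G] [TopologicalSpace G] [IsTopologicalGroup G] [LocallyCompactSpace G]
  [MeasurableSpace G] [BorelSpace G]
variable {Γ : Subgroup G} [DiscreteTopology Γ] [hΓ : IsClosed (Γ : Set G)]
  [MeasurableSpace (G ⧸ Γ)] [BorelSpace (G ⧸ Γ)]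
variable {μQ : Measure (G ⧸ Γ)} [SMulInvariantMeasure G (G ⧸ Γ) μQ]
variable {HG CG SK SigIdxG : Type}
variable [NormedAddCommGroup HG] [InnerProductSpace ℂ HG] [CompleteSpace HG]
variable [NormedAddCommGroup CG] [NormedSpace ℂ CG] [TopologicalSpace SK]
variable (C : RegCoreCarrier G Γ μQ HG CG SK SigIdxG)

/-- **`RegCoreCarrier.Analytic` from `hatτ_complete` in the cocompact Haar model**: `discreteDecomp` is pv06-g3's
`CompactApprox.discreteDecomp_haar`, transported along `μQ = map π (μ|𝓕)` and `koopman = ρHom`. -/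
theorem analytic_of_cocompact {μ : Measure G} (hM : RegularRep.IsCocompactHaarModel Γ μQ μ)
    (hτ : (⨆ j, C.hatτ j).topologicalClosure = ⊤) : C.Analytic := by
  obtain ⟨𝓕, h𝓕, hν⟩ := hM.exists_fundamentalDomain
  haveI := hM.isHaar
  haveI := hM.regular
  haveI := hM.rightInvariant
  haveI := hM.countable
  haveI := hM.compactQuotient
  subst hν
  have h := PerL34.CompactApprox.discreteDecomp_haar hΓ μ h𝓕
  rw [← RegularRep.koopman_eq_ρHom] at h
  exact ⟨h, hτ⟩

/-- … and the (U)-version record from `hatτ_complete` and the unit law `ω(1) = id`. -/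
theorem analyticU_of_cocompact {μ : Measure G} (hM : RegularRep.IsCocompactHaarModel Γ μQ μ)
    (hτ : (⨆ j, C.hatτ j).topologicalClosure = ⊤) (h1 : ∀ Φ, C.omg 1 Φ = Φ) : C.AnalyticU where
  discreteDecomp := (C.analytic_of_cocompact hM hτ).discreteDecomp
  hatτ_complete := hτ
  omg_one := h1

/-- gen 3's full core record, same hypotheses. -/
theorem repAnalytic_of_cocompact {μ : Measure G} (hM : RegularRep.IsCocompactHaarModel Γ μQ μ)
    (hτ : (⨆ j, C.hatτ j).topologicalClosure = ⊤) : C.toRepCoreCarrier.Analytic :=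
  RegCoreCarrier.toRepCoreCarrier_analytic (C.analytic_of_cocompact hM hτ)

end RegCoreCarrier

/-! ## 3. Universe level -/

namespace Universe

open HodgeCM.Prior.Perl34File HodgeCM.Prior.Perl34File.Perl34

namespace RegThetaCarrier

variable {U : Universe} (D : U.RegThetaCarrier)

/-- **The analytic hypotheses of a COCOMPACT regular-model carrier**, over a family `μG` of measures on the groups
`U(W)(𝔸)` of the contexts: per context the structural model datum `cocompact` and the NAMED ANALYTIC PROPOSITIONS
`hatτ_complete`, `omg_one` (core) and `AX5b_ϑ_cont`, `AX12_transl_cont`, `AX12_unfold`, `AX8_annihilation` on each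
torus side — 2 + 4 + 4 = 10. -/
structure AnalyticC (μG : ∀ {L : CMField} {ι₁ : L →+* ℂ} (V : HermSpace3 L ι₁) (c : SeesawCtx L),
    Measure (D.G V c)) : Prop where
  /-- structural: `[U(W)]` compact, `μQ` the Haar quotient measure (ll. 384–385) -/
  cocompact : ∀ {L : CMField} {ι₁ : L →+* ℂ} (V : HermSpace3 L ι₁) (c : SeesawCtx L),
    RegularRep.IsCocompactHaarModel (D.Gam V c) (D.μQ V c) (μG V c)
  /-- the `G_U`-side isotypic pieces `τ̂` exhaust `L²([G_U])` -/
  hatτ_complete : ∀ {L : CMField} {ι₁ : L →+* ℂ} (V : HermSpace3 L ι₁) (c : SeesawCtx L),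
    (⨆ j, (D.core V c).hatτ j).topologicalClosure = ⊤
  /-- the unit law of the Weil representation `ω` -/
  omg_one : ∀ {L : CMField} {ι₁ : L →+* ℂ} (V : HermSpace3 L ι₁) (c : SeesawCtx L) (Φ : D.SK V c),
    (D.core V c).omg 1 Φ = Φ
  t12 : ∀ {L : CMField} {ι₁ : L →+* ℂ} (V : HermSpace3 L ι₁) (c : SeesawCtx L), (D.t12 V c).AnalyticU (μG V c)
  t34 : ∀ {L : CMField} {ι₁ : L →+* ℂ} (V : HermSpace3 L ι₁) (c : SeesawCtx L), (D.t34 V c).AnalyticU (μG V c)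

variable {D}
variable {μG : ∀ {L : CMField} {ι₁ : L →+* ℂ} (V : HermSpace3 L ι₁) (c : SeesawCtx L), Measure (D.G V c)}

/-- ten ⟹ eleven (`discreteDecomp` is pv06-g3's theorem in the cocompact model). -/
theorem AnalyticC.toAnalyticU (hA : D.AnalyticC μG) : D.AnalyticU μG where
  core := fun V c => (D.core V c).analyticU_of_cocompact (hA.cocompact V c) (hA.hatτ_complete V c) (hA.omg_one V c)
  t12 := hA.t12
  t34 := hA.t34

/-- ten ⟹ twelve ⟹ gen 3's fifteen. -/
theorem AnalyticC.toAnalytic (hA : D.AnalyticC μG) : D.Analytic :=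
  haveI : ∀ {L : CMField} {ι₁ : L →+* ℂ} (V : HermSpace3 L ι₁) (c : SeesawCtx L),
      IsFiniteMeasureOnCompacts (μG V c) := fun V c =>
    haveI := (hA.cocompact V c).isHaar
    inferInstance
  haveI : ∀ {L : CMField} {ι₁ : L →+* ℂ} (V : HermSpace3 L ι₁) (c : SeesawCtx L),
      (μG V c).IsOpenPosMeasure := fun V c =>
    haveI := (hA.cocompact V c).isHaar
    inferInstance
  hA.toAnalyticU.toAnalytic

end RegThetaCarrier

end Universe

/-! ## 4. END STATE -/

namespace Assembly

open HodgeCM.Prior.Perl34File HodgeCM.Prior.Perl34File.Perl34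
open HodgeCM.Universe (RegThetaCarrier ThetaModel)

variable (U : Universe)

/-- **PerL over a cocompact regular-model carrier.** -/
theorem perL_ofRegCarrierC (M : U.ModelAxioms) (D : U.RegThetaCarrier)
    {μG : ∀ {L : CMField} {ι₁ : L →+* ℂ} (V : HermSpace3 L ι₁) (c : SeesawCtx L), Measure (D.G V c)}
    (hA : D.AnalyticC μG) (A : (ThetaModel.ofRegCarrier D hA.toAnalytic).Inputs)
    (hHR : U.Fact_hodgeRiemann20) : U.PerL :=
  perL_ofRegCarrier U M D hA.toAnalytic A hHR

/-- **COR-CM, END STATE over a cocompact regular-model carrier**: per seesaw context the structural cocompact Haar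
model and TEN named analytic propositions (`hatτ_complete`, `omg_one`; `AX5b_ϑ_cont`, `AX12_transl_cont`,
`AX12_unfold`, `AX8_annihilation` on each torus side); the model facts, the ten theta inputs, Hodge–Riemann, and the
QW8 facts.  `R_unitary`, `discreteDecomp`, `AX12_E_transl` ×2, `AX12_unfold_lift` ×2, `AX12_molly` ×2 and
`AX9_w_vector` ×2 of the gen-2 carrier are THEOREMS in this model. -/
theorem COR_CM_endState_ofRegCarrierC (M : U.ModelAxioms) (h29 : U.Fact_weightSpan) (h30 : U.Fact_weightHodge)
    (hE : U.Qw8ExtProd) (hD : U.Qw8DualPushPull) (hMi : U.Qw8Milne) (D : U.RegThetaCarrier)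
    {μG : ∀ {L : CMField} {ι₁ : L →+* ℂ} (V : HermSpace3 L ι₁) (c : SeesawCtx L), Measure (D.G V c)}
    (hA : D.AnalyticC μG) (A : (ThetaModel.ofRegCarrier D hA.toAnalytic).Inputs)
    (hHR : U.Fact_hodgeRiemann20) : U.HC_CM :=
  COR_CM_endState_ofRegCarrier U M h29 h30 hE hD hMi D hA.toAnalytic A hHR

end Assembly

end HodgeCM

end
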